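import Literature.AnabelianGeometry.AbsoluteAnabelian.MLFGaloisModelPairs

/-!
# The mono-analytic model data `(k, k̄, id : G_k ⥲ G_k)` ([AbsTopIII] Def 3.1 (i)/(ii): non-vacuity)

S. Mochizuki, *Topics in absolute anabelian geometry III*, §3, Def. 3.1 (i), (ii) pp. 66–67 (bib key
`MochizukiAbsTopIII2015`; locators = kurims manuscript pages, lit key `paper:url-5493eb38cbb7`).
Def. 3.1 (i): "Let `Π_k` be a topological group, equipped with a continuous surjection `ε_k : Π_k ↠ G_k`";
(ii): "if `ε_k` is an isomorphism, then we shall say that `(Π ↷ M)` is of mono-analytic type".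

The tree types model data as `ModelMLFGaloisData k K` (`MLFGaloisModel.lean`, seat abc-iut-L4-t2) but so
far contains no INSTANCE of it; every non-vacuity statement of the form "the model pair of model data `D`
is an MLF-Galois pair" (`isMLFGaloisMonoidPair_tmPair`, `MLFGaloisModelPairs.lean`) therefore still takes
`D` as a hypothesis.  This file closes that gap with the canonical MONO-ANALYTIC model:

* `ModelMLFGaloisData.galois k K` — `Π_k := G_k = Gal(k̄/k)` (Krull topology), `ε_k := id`;
  `galois_aug_bijective`, `galois_aug_isOpenMap`;
* for an `MLFClosure` `C` (e.g. the concrete `MLFClosure.padic p` of seat abc-iut-L3-t11): the pairs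
  `(G_k ↷ 𝒪_k̄^⊳)`, `(G_k ↷ 𝒪_k̄^×)`, `(G_k ↷ k̄^×)`, `(G_k ↷ k̄)` ARE MLF-Galois pairs and ARE of mono-analytic
  type (`isMLFGaloisMonoidPair_galois_tmPair`, `isOfMonoAnalyticTypeMonoid_galois_tmPair`, …,
  `isMLFGaloisFieldPair_galois`, `isOfMonoAnalyticTypeField_galois`) — unconditional non-vacuity of
  Def. 3.1 (ii) for all four types `TM, TCG, TLG, TF`.

(The Kummer theory of `MonoidKummerModel.lean` applies to `galois k K` with `ε_k` open, so its Kummer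
maps are injective at EVERY open subgroup of `G_k` — recorded there, not here.)
HONEST FRAMING: definitions and trivial verifications; nothing here bears on [IUTchIII] Cor. 3.12.
-/

noncomputable section

universe u

namespace Literature.AnabelianGeometry.AbsoluteAnabelian

namespace ModelMLFGaloisData

variable (k : Type u) [Field k] (K : Type u) [Field K] [Algebra k K]

/-- **The mono-analytic model data**: `Π_k := G_k = Gal(k̄/k)` with its Krull topology and
`ε_k := id : G_k ⥲ G_k` ("if `ε_k` is an isomorphism … of mono-analytic type", Def. 3.1 (ii)).
[cite: MochizukiAbsTopIII2015, Definition 3.1 (i) p.66] -/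
def galois : ModelMLFGaloisData k K where
  Pi := K ≃ₐ[k] K
  aug := MonoidHom.id _
  continuous_aug := continuous_id
  aug_surjective := Function.surjective_id

/-- `ε_k = id` for the mono-analytic model data. [cite: MochizukiAbsTopIII2015, Definition 3.1 (i) p.66] -/
@[simp] theorem galois_aug_apply (σ : (galois k K).Pi) : (galois k K).aug σ = σ := rfl

/-- `ε_k` of the mono-analytic model data is bijective. [cite: MochizukiAbsTopIII2015, Definition 3.1 (ii) p.67] -/
theorem galois_aug_bijective : Function.Bijective (galois k K).aug := Function.bijective_id

/-- `ε_k` of the mono-analytic model data is an open map (it is the identity).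
[cite: MochizukiAbsTopIII2015, Definition 3.1 (ii) p.67] -/
theorem galois_aug_isOpenMap : IsOpenMap (galois k K).aug := IsOpenMap.id

end ModelMLFGaloisData

section NonVacuity

variable (C : MLFClosure.{u})

/-- **Def 3.1 (ii) is inhabited, `T = TM`**: `(G_k ↷ 𝒪_k̄^⊳)` is an MLF-Galois `TM`-pair, for every MLF with
an algebraic closure (e.g. `MLFClosure.padic p`). [cite: MochizukiAbsTopIII2015, Definition 3.1 (ii) p.67] -/
theorem isMLFGaloisMonoidPair_galois_tmPair :
    IsMLFGaloisMonoidPair .TM (ModelMLFGaloisData.galois C.k C.K).tmPair :=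
  isMLFGaloisMonoidPair_tmPair C _

/-- **Def 3.1 (ii), `T = TCG`**: `(G_k ↷ 𝒪_k̄^×)` is an MLF-Galois `TCG`-pair. [cite: MochizukiAbsTopIII2015, Definition 3.1 (ii) p.67] -/
theorem isMLFGaloisMonoidPair_galois_tcgPair :
    IsMLFGaloisMonoidPair .TCG (ModelMLFGaloisData.galois C.k C.K).tcgPair :=
  isMLFGaloisMonoidPair_tcgPair C _

/-- **Def 3.1 (ii), `T = TLG`**: `(G_k ↷ k̄^×)` is an MLF-Galois `TLG`-pair. [cite: MochizukiAbsTopIII2015, Definition 3.1 (ii) p.67] -/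
theorem isMLFGaloisMonoidPair_galois_tlgPair :
    IsMLFGaloisMonoidPair .TLG (ModelMLFGaloisData.galois C.k C.K).tlgPair :=
  isMLFGaloisMonoidPair_tlgPair C _

/-- **Def 3.1 (ii), `T = TF`**: `(G_k ↷ k̄)` is an MLF-Galois `TF`-pair (via the identity isomorphism of
`TF`-pairs). [cite: MochizukiAbsTopIII2015, Definition 3.1 (ii) p.67] -/
theorem isMLFGaloisFieldPair_galois :
    IsMLFGaloisFieldPair (ModelMLFGaloisData.galois C.k C.K).fieldPair :=
  ⟨⟨C, _, ⟨⟨ContinuousMulEquiv.refl _, RingEquiv.refl _, fun _ _ => rfl⟩⟩⟩⟩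

/-- **"Of mono-analytic type" is inhabited, `T = TM`**: `(G_k ↷ 𝒪_k̄^⊳)` is of mono-analytic type
(`ε_k = id` is bijective and open). [cite: MochizukiAbsTopIII2015, Definition 3.1 (ii) p.67] -/
theorem isOfMonoAnalyticTypeMonoid_galois_tmPair :
    IsOfMonoAnalyticTypeMonoid .TM (ModelMLFGaloisData.galois C.k C.K).tmPair :=
  ⟨⟨C, ModelMLFGaloisData.galois C.k C.K, _,
    ⟨ModelMLFGaloisData.galois_aug_bijective C.k C.K, ModelMLFGaloisData.galois_aug_isOpenMap C.k C.K⟩,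
    ModelMLFGaloisData.monoidPair_TM _, ⟨GaloisMonoidPair.Iso.refl _⟩⟩⟩

/-- `T = TCG`: `(G_k ↷ 𝒪_k̄^×)` is of mono-analytic type. [cite: MochizukiAbsTopIII2015, Definition 3.1 (ii) p.67] -/
theorem isOfMonoAnalyticTypeMonoid_galois_tcgPair :
    IsOfMonoAnalyticTypeMonoid .TCG (ModelMLFGaloisData.galois C.k C.K).tcgPair :=
  ⟨⟨C, ModelMLFGaloisData.galois C.k C.K, _,
    ⟨ModelMLFGaloisData.galois_aug_bijective C.k C.K, ModelMLFGaloisData.galois_aug_isOpenMap C.k C.K⟩,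
    ModelMLFGaloisData.monoidPair_TCG _, ⟨GaloisMonoidPair.Iso.refl _⟩⟩⟩

/-- `T = TLG`: `(G_k ↷ k̄^×)` is of mono-analytic type. [cite: MochizukiAbsTopIII2015, Definition 3.1 (ii) p.67] -/
theorem isOfMonoAnalyticTypeMonoid_galois_tlgPair :
    IsOfMonoAnalyticTypeMonoid .TLG (ModelMLFGaloisData.galois C.k C.K).tlgPair :=
  ⟨⟨C, ModelMLFGaloisData.galois C.k C.K, _,
    ⟨ModelMLFGaloisData.galois_aug_bijective C.k C.K, ModelMLFGaloisData.galois_aug_isOpenMap C.k C.K⟩,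
    ModelMLFGaloisData.monoidPair_TLG _, ⟨GaloisMonoidPair.Iso.refl _⟩⟩⟩

/-- `T = TF`: `(G_k ↷ k̄)` is of mono-analytic type. [cite: MochizukiAbsTopIII2015, Definition 3.1 (ii) p.67] -/
theorem isOfMonoAnalyticTypeField_galois :
    IsOfMonoAnalyticTypeField (ModelMLFGaloisData.galois C.k C.K).fieldPair :=
  ⟨⟨C, ModelMLFGaloisData.galois C.k C.K,
    ⟨ModelMLFGaloisData.galois_aug_bijective C.k C.K, ModelMLFGaloisData.galois_aug_isOpenMap C.k C.K⟩,
    ⟨⟨ContinuousMulEquiv.refl _, RingEquiv.refl _, fun _ _ => rfl⟩⟩⟩⟩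

end NonVacuity

end Literature.AnabelianGeometry.AbsoluteAnabelian

end
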